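import Summits.BirchSwinnertonDyer.BirchSwinnertonDyer.Theorems.AlignedTransportAtTwoOffStratumPartitionTwistFamilyZhaiTransport
import Summits.BirchSwinnertonDyer.Uniform.U2.TwoTrivialIffOddTrace
import Summits.BirchSwinnertonDyer.Rank1Residual.Supersingular.RationalLadder
import HarnessLib

/-!
# Route `AlignedTransportAtTwo`, crux C2 `MainConjectureOfRankZeroBSDAtTwo` (stmt-22298), line `birth` — PRINT-TRANSPORT of `BSD(W, 2)` on the
# `a_q`-odd twist class of `1727a1`: EXPLICIT MEMBERS `1727a1^{(−3)}` (`N = 15543`), `1727a1^{(−7)}` (`N = 84623`), `1727a1^{(21)}`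
# (`N = 761607`), `1727a1^{(29)}` (`N = 1452407`) — the class condition «`a_q(1727a1)` odd» KERNEL-DECIDED by certified point counts

HONEST FRAMING (cell `bsd-f1-sign2`, WIDTH-5 attach seat `bsd-line-att-p4` g24; `--supports stmt-BirchSwinnertonDyer-22298 --as helper`).
THEOREMS ONLY (no `def`, no named fact, no `sorry`). BSD is NOT proved; nothing is asserted — every row is CONDITIONAL on the displayed PRINT
named facts and the seed's two displayed data. Sequel of `…TwistFamilyZhaiTransport` (same seat, same gen).

WHY. The parent file's `bsdp_two_twist_oddTrace_1727a1` carries the class condition in the LMFDB-checkable form «`a_q(1727a1)` odd for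
every prime `q ∣ d`». Here it is DECIDED IN THE KERNEL for `q ∈ {3, 7, 29}` from certified point counts of Cremona's model
`[1, −1, 0, −76, 275]` (`#Ẽ(𝔽₃) = 1`, `#Ẽ(𝔽₇) = 9`, `#Ẽ(𝔽₂₉) = 25`; `Supersingular.reductionPointCount_eq_of_intModel_countPoints`,
`decide +kernel`; `a_q` odd ⟺ `#Ẽ(𝔽_q)` odd, `U2.odd_frobeniusTrace_iff_odd_reductionPointCount`), giving four explicit members. The member
`d = −3` is g23's `…TwistFamilyZhaiExplicit.bsdp_two_twist_1727a1_neg3` (there: cell road, PRINT⁹ + `TowerGapAtTwo 1727a1`); it is NOT in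
Zhai's arXiv-v2 split sub-family (`11` is inert in `ℚ(√−3)`), so its `BSD₂` is not a printed sentence — here it becomes PRINT-ASSEMBLY
(U2 transport: Zhai 1.1′ + Mazur–Rubin L. 2.10 + Abbes–Ullmo + modularity + Creutz–Miller + GZK) + {`Dt`, `hL`}, with NO certificate.

PARTITION CURRENCY (D-0171): explicit witnesses that `T_Z ∖ T_Z^split` of `1727a1` is non-empty and print-transport. Beyond-print theorem: no.
BSD is NOT proved.

References: [Zhai2016] Thm. 1.1; [MazurRubin2010] Lemma 2.10; [AbbesUllmo1996] Thm. A; [CreutzMiller2012] Thm. 1.1; [Miller2011LMS] Def. 1.1;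
[CremonaAlgorithms1997] Table 1 (`1727a1`); [SilvermanAEC2009] V.2.
-/

set_option autoImplicit false
set_option linter.dupNamespace false

noncomputable section

open scoped Classical

open WeierstrassCurve NumberField
open Literature.NumberTheory.EllipticCurves Literature.NumberTheory.EllipticCurves.ModularForms
open Literature.NumberTheory.EllipticCurves.Rank1Residual Literature.NumberTheory.EllipticCurves.Rank1Residual.Typed
open Literature.NumberTheory.EllipticCurves.CoatesLiTianZhai2015 Literature.NumberTheory.EllipticCurves.Zhai2016
open Summit.BirchSwinnertonDyer.Rank1Residual Summit.BirchSwinnertonDyer.Rank1Residual.X5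
open Summit.BirchSwinnertonDyer.Uniform
open Summit.BirchSwinnertonDyer.BirchSwinnertonDyer.Theorems.TowerClass
open Summit.BirchSwinnertonDyer.BirchSwinnertonDyer.Theorems.AlignedTransportAtTwoTwistFamilySmallSeeds
open Summit.BirchSwinnertonDyer.BirchSwinnertonDyer.Theorems.AlignedTransportAtTwoTwistFamilyZhaiTransport
open Summit.BirchSwinnertonDyer.BirchSwinnertonDyer.Theorems

namespace Summit.BirchSwinnertonDyer.BirchSwinnertonDyer.Theorems.AlignedTransportAtTwoTwistFamilyZhaiTransportExplicit

/-! ## §1 Certified point counts of `1727a1` and the parity of `a_q` at `q = 3, 7, 29` -/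

/-- **`#Ẽ(𝔽₃) = 1` for `1727a1`** (`y² + xy = x³ + 2x² + 2x + 2` over `𝔽₃` has no affine point; certified count, `decide +kernel`).
[cite: CremonaAlgorithms1997, Table 1] -/
theorem reductionPointCount_3_1727a1 : c1727a1.reductionPointCount 3 = 1 := by
  haveI : Fact (Nat.Prime 3) := ⟨Nat.prime_three⟩
  exact Supersingular.reductionPointCount_eq_of_intModel_countPoints (Instances.integralModelInt_baseChange_int M1727a1) 3 (by norm_num)
    (by decide +kernel) (by decide +kernel)

/-- **`#Ẽ(𝔽₇) = 9` for `1727a1`** (certified count). [cite: CremonaAlgorithms1997, Table 1] -/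
theorem reductionPointCount_7_1727a1 : c1727a1.reductionPointCount 7 = 9 := by
  haveI : Fact (Nat.Prime 7) := ⟨by norm_num⟩
  exact Supersingular.reductionPointCount_eq_of_intModel_countPoints (Instances.integralModelInt_baseChange_int M1727a1) 7 (by norm_num)
    (by decide +kernel) (by decide +kernel)

/-- **`#Ẽ(𝔽₂₉) = 25` for `1727a1`** (certified count). [cite: CremonaAlgorithms1997, Table 1] -/
theorem reductionPointCount_29_1727a1 : c1727a1.reductionPointCount 29 = 25 := by
  haveI : Fact (Nat.Prime 29) := ⟨by norm_num⟩
  exact Supersingular.reductionPointCount_eq_of_intModel_countPoints (Instances.integralModelInt_baseChange_int M1727a1) 29 (by norm_num)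
    (by decide +kernel) (by decide +kernel)

/-- `a₃(1727a1) = 3` is odd. [cite: Zhai2016, §1 («N_q odd»)] -/
theorem odd_frobeniusTrace_3_1727a1 : Odd (c1727a1.frobeniusTrace 3) := by
  rw [U2.odd_frobeniusTrace_iff_odd_reductionPointCount _ Nat.prime_three (by norm_num), reductionPointCount_3_1727a1]
  exact ⟨0, rfl⟩

/-- `a₇(1727a1) = −1` is odd. [cite: Zhai2016, §1 («N_q odd»)] -/
theorem odd_frobeniusTrace_7_1727a1 : Odd (c1727a1.frobeniusTrace 7) := by
  rw [U2.odd_frobeniusTrace_iff_odd_reductionPointCount _ (by norm_num : Nat.Prime 7) (by norm_num), reductionPointCount_7_1727a1]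
  exact ⟨4, rfl⟩

/-- `a₂₉(1727a1) = 5` is odd. [cite: Zhai2016, §1 («N_q odd»)] -/
theorem odd_frobeniusTrace_29_1727a1 : Odd (c1727a1.frobeniusTrace 29) := by
  rw [U2.odd_frobeniusTrace_iff_odd_reductionPointCount _ (by norm_num : Nat.Prime 29) (by norm_num), reductionPointCount_29_1727a1]
  exact ⟨12, rfl⟩

/-! ## §2 Four explicit members of the `a_q`-odd class of `1727a1`, `BSD(W, 2)` by print-transport -/

section Members

variable (W : WeierstrassCurve ℚ) [W.IsElliptic] [W.IsGloballyMinimal]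
  (h11 : thm11_ordTwo_LAlg_twist_eq_zero') (h12 : thm12_ordTwo_LAlg_twist_eq_one')
  (hMR' : MazurRubin2010.d2_eq_of_lemma210_rat) (hmod : exists_isNewformOf)
  (hAU : abbesUllmo_not_dvd_maninConstant_of_not_dvd_level)
  (hCM : bsdTriple_of_rank_le_one_of_conductor_lt) (hGZK : rank_eq_analyticRank_of_analyticRank_le_one)

/-- A prime dividing `−p` or `p` is `p`. [folklore] -/
theorem eq_of_prime_dvd_prime {q p : ℕ} (hq : q.Prime) (hp : p.Prime) (h : (q : ℤ) ∣ (p : ℤ)) : q = p :=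
  (Nat.prime_dvd_prime_iff_eq hq hp).mp (by exact_mod_cast h)

include h11 h12 hMR' hmod hAU hCM hGZK in
/-- **`BSD(W, 2)` by PRINT-TRANSPORT for every globally minimal model `W` of `1727a1^{(−3)}`** (conductor `15543 = 3²·1727`; `a₃(1727a1) = 3`
odd, kernel-decided; `11` is inert in `ℚ(√−3)`, so this member is OUTSIDE Zhai's arXiv-v2 split sub-family): `r_an(W) = 0 ∧ rank 0 ∧
Ш(W)[2^∞] = 0 ∧ c(W)` odd `∧ BSD(W, 2)`, modulo PRINT⁷ {Zhai 1.1′/1.2′, Mazur–Rubin L. 2.10, modularity, Abbes–Ullmo, Creutz–Miller, GZK} +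
displayed {`Dt`, `hL`} of `1727a1`. No Kato, no tower-gap certificate. CONDITIONAL; BSD is NOT proved. [cite: Zhai2016, Thm. 1.1]
[cite: MazurRubin2010, Lemma 2.10] [cite: CreutzMiller2012, Thm. 1.1] [cite: AbbesUllmo1996, Thm. A] [cite: Miller2011LMS, Def. 1.1] -/
theorem bsdp_two_twist_1727a1_neg3_transport [NeZero (c1727a1.conductorNorm ℤ)]
    (Dt : ModularParametrizationData c1727a1 (c1727a1.conductorNorm ℤ)) (hopt : Zhai2021.IsOptimalDatum c1727a1 Dt)
    (hL : ∃ x : ℚ, IsLAlg c1727a1 x ∧ x ≠ 0 ∧ padicValRat 2 x = 0)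
    {c : VariableChange ℚ} (hc : c • c1727a1.quadraticTwist ((-3 : ℤ) : ℚ) = W) :
    W.analyticRank = 0 ∧ W.mordellWeilRank = 0 ∧ AddCommGroup.primaryComponent W.sha 2 = ⊥ ∧ Odd W.tamagawaProduct ∧ BSDp W 2 := by
  refine bsdp_two_twist_oddTrace_1727a1 W h11 h12 hMR' hmod hAU hCM hGZK Dt hopt hL
    (Int.squarefree_natAbs.mp (by rw [show (-3 : ℤ).natAbs = 3 from rfl]; exact Nat.prime_three.squarefree)) (by decide) (by decide)
    (by decide) (fun q hq hqd ↦ ?_) hc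
  rw [show (-3 : ℤ) = -((3 : ℕ) : ℤ) by norm_num, Int.dvd_neg] at hqd
  rw [eq_of_prime_dvd_prime hq Nat.prime_three hqd]
  exact odd_frobeniusTrace_3_1727a1

include h11 h12 hMR' hmod hAU hCM hGZK in
/-- **`BSD(W, 2)` by PRINT-TRANSPORT for every globally minimal model `W` of `1727a1^{(−7)}`** (conductor `84623 = 7²·1727`; `a₇(1727a1) = −1` odd),
modulo PRINT⁷ + {`Dt`, `hL`}. CONDITIONAL; BSD is NOT proved. [cite: Zhai2016, Thm. 1.1] [cite: MazurRubin2010, Lemma 2.10]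
[cite: CreutzMiller2012, Thm. 1.1] [cite: Miller2011LMS, Def. 1.1] -/
theorem bsdp_two_twist_1727a1_neg7_transport [NeZero (c1727a1.conductorNorm ℤ)]
    (Dt : ModularParametrizationData c1727a1 (c1727a1.conductorNorm ℤ)) (hopt : Zhai2021.IsOptimalDatum c1727a1 Dt)
    (hL : ∃ x : ℚ, IsLAlg c1727a1 x ∧ x ≠ 0 ∧ padicValRat 2 x = 0)
    {c : VariableChange ℚ} (hc : c • c1727a1.quadraticTwist ((-7 : ℤ) : ℚ) = W) :
    W.analyticRank = 0 ∧ W.mordellWeilRank = 0 ∧ AddCommGroup.primaryComponent W.sha 2 = ⊥ ∧ Odd W.tamagawaProduct ∧ BSDp W 2 := by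
  refine bsdp_two_twist_oddTrace_1727a1 W h11 h12 hMR' hmod hAU hCM hGZK Dt hopt hL
    (Int.squarefree_natAbs.mp (by rw [show (-7 : ℤ).natAbs = 7 from rfl]; exact (by norm_num : Nat.Prime 7).squarefree)) (by decide)
    (by decide) (by decide) (fun q hq hqd ↦ ?_) hc
  rw [show (-7 : ℤ) = -((7 : ℕ) : ℤ) by norm_num, Int.dvd_neg] at hqd
  rw [eq_of_prime_dvd_prime hq (by norm_num) hqd]
  exact odd_frobeniusTrace_7_1727a1

include h11 h12 hMR' hmod hAU hCM hGZK in
/-- **`BSD(W, 2)` by PRINT-TRANSPORT for every globally minimal model `W` of `1727a1^{(21)}`** (conductor `761607 = 3²·7²·1727`; `a₃`, `a₇` odd;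
a composite member, `M = (−3)(−7)`), modulo PRINT⁷ + {`Dt`, `hL`}. CONDITIONAL; BSD is NOT proved. [cite: Zhai2016, Thm. 1.1]
[cite: MazurRubin2010, Lemma 2.10] [cite: CreutzMiller2012, Thm. 1.1] [cite: Miller2011LMS, Def. 1.1] -/
theorem bsdp_two_twist_1727a1_21_transport [NeZero (c1727a1.conductorNorm ℤ)]
    (Dt : ModularParametrizationData c1727a1 (c1727a1.conductorNorm ℤ)) (hopt : Zhai2021.IsOptimalDatum c1727a1 Dt)
    (hL : ∃ x : ℚ, IsLAlg c1727a1 x ∧ x ≠ 0 ∧ padicValRat 2 x = 0)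
    {c : VariableChange ℚ} (hc : c • c1727a1.quadraticTwist ((21 : ℤ) : ℚ) = W) :
    W.analyticRank = 0 ∧ W.mordellWeilRank = 0 ∧ AddCommGroup.primaryComponent W.sha 2 = ⊥ ∧ Odd W.tamagawaProduct ∧ BSDp W 2 := by
  have hsq : Squarefree (21 : ℤ) := by
    rw [show (21 : ℤ) = ((3 * 7 : ℕ) : ℤ) by norm_num]
    exact Int.squarefree_natCast.mpr
      ((Nat.squarefree_mul ((Nat.coprime_primes Nat.prime_three (by norm_num)).mpr (by norm_num))).mpr
        ⟨Nat.prime_three.squarefree, (by norm_num : Nat.Prime 7).squarefree⟩)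
  refine bsdp_two_twist_oddTrace_1727a1 W h11 h12 hMR' hmod hAU hCM hGZK Dt hopt hL hsq (by decide) (by decide) (by decide)
    (fun q hq hqd ↦ ?_) hc
  rw [show (21 : ℤ) = ((3 * 7 : ℕ) : ℤ) by norm_num, Int.natCast_dvd_natCast] at hqd
  rcases (Nat.Prime.dvd_mul hq).mp hqd with h | h
  · rw [(Nat.prime_dvd_prime_iff_eq hq Nat.prime_three).mp h]; exact odd_frobeniusTrace_3_1727a1
  · rw [(Nat.prime_dvd_prime_iff_eq hq (by norm_num)).mp h]; exact odd_frobeniusTrace_7_1727a1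

include h11 h12 hMR' hmod hAU hCM hGZK in
/-- **`BSD(W, 2)` by PRINT-TRANSPORT for every globally minimal model `W` of `1727a1^{(29)}`** (conductor `1452407 = 29²·1727`; `a₂₉(1727a1) = 5` odd),
modulo PRINT⁷ + {`Dt`, `hL`}. CONDITIONAL; BSD is NOT proved. [cite: Zhai2016, Thm. 1.1] [cite: MazurRubin2010, Lemma 2.10]
[cite: CreutzMiller2012, Thm. 1.1] [cite: Miller2011LMS, Def. 1.1] -/
theorem bsdp_two_twist_1727a1_29_transport [NeZero (c1727a1.conductorNorm ℤ)]
    (Dt : ModularParametrizationData c1727a1 (c1727a1.conductorNorm ℤ)) (hopt : Zhai2021.IsOptimalDatum c1727a1 Dt)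
    (hL : ∃ x : ℚ, IsLAlg c1727a1 x ∧ x ≠ 0 ∧ padicValRat 2 x = 0)
    {c : VariableChange ℚ} (hc : c • c1727a1.quadraticTwist ((29 : ℤ) : ℚ) = W) :
    W.analyticRank = 0 ∧ W.mordellWeilRank = 0 ∧ AddCommGroup.primaryComponent W.sha 2 = ⊥ ∧ Odd W.tamagawaProduct ∧ BSDp W 2 := by
  refine bsdp_two_twist_oddTrace_1727a1 W h11 h12 hMR' hmod hAU hCM hGZK Dt hopt hL
    (Int.squarefree_natCast.mpr (by norm_num : Nat.Prime 29).squarefree) (by decide) (by decide) (by decide) (fun q hq hqd ↦ ?_) hc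
  rw [eq_of_prime_dvd_prime hq (by norm_num) hqd]
  exact odd_frobeniusTrace_29_1727a1

end Members

end Summit.BirchSwinnertonDyer.BirchSwinnertonDyer.Theorems.AlignedTransportAtTwoTwistFamilyZhaiTransportExplicit

end
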